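import Summits.ResolutionOfSingularities.ResolutionOfSingularities.Theorems.HomologicalConductorSurfaceTerminationGenusChart
import HarnessLib

/-!
# Kill test `SurfaceTermination` / W4.4 support programme «P_G LERAY», pointwise form:
# Leray in degree one along a proper birational morphism of regular surfaces WITHOUT Lipman (1.2)

Route `ResolutionOfSingularities/HomologicalConductor`, crux chain W4.4 (supports
stmt-ResolutionOfSingularities-19943); F-79 sub-cell «2-reg» of the D-0154 (2) RES inputs cell, row
F79-L(Ⅰ) = brick (L) of the planner skeleton `F79_2reg_BRICKS_SKELETON.lean` (`stub_leray`) under OPTION Ⅰ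
(critic R59 (8): Summits-side, universe 0, new declarations next to `GenusDescent.cechZ1_le_cechB1_chart`).
OURS (cell res-hironaka; text = res-inputs-plan-1 g8's certified copy `F79_L_optionI_COPYCHECK_scratch.lean`
fb4a32144065455d, filed by res-inputs-p-9c g3 with the decl names of ROWS v4); AI-written, weaker than expert
review; nothing of the manuscript under review (Hironaka 2017) is used.  Nothing here discharges the named
fact `Lipman1969_1_2` ((1.2) in general stays PRINT); no summit statement is proved; resolution in
dim ≥ 4 / char p is NOT proved.

MECHANISM (the Genus line's «P_G LERAY» of `…GenusLocalResolution` / `…GenusDomination`, with the named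
fact `h12 : Lipman1969_1_2` replaced by a POINTWISE hypothesis): for `ρ : Z → X` proper birational, `Z`, `X`
regular, `X` integral, `πX : X → Spec T` proper, if `Ȟ¹ = 0` on `Z ×_X Spec 𝒪_{X,x} → Spec 𝒪_{X,x}` for
every `x` (at `dim 𝒪_{X,x} ≤ 1` this is automatic, `hasTrivialCechH1_pullback_snd_fromSpecStalk_of_dimTwo`)
then chartwise `R¹ρ_*𝒪_Z = 0` (`cechZ1_le_cechB1_chart_of_forall_stalk_mem`), hence
`Ȟ¹(𝒰, 𝒪_X) ↠ Ȟ¹(𝒲, 𝒪_Z)` for affine covers (`cechRefineH1_comp_cechComapH1_surjective_of_forall_stalk`,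
using `ρ_*𝒪_Z = 𝒪_X`: `isIso_app_of_isBirational_of_isRegular`), hence `Ȟ¹(X, 𝒪) = 0 ⇒ Ȟ¹(Z, 𝒪) = 0` for
EVERY finite affine cover of `Z` (`hasTrivialCechH1_comp_of_forall_stalk`: finite affine cover of `X`
`exists_finite_affine_cover`, refinement `exists_finite_affine_refinement`, affine intersections
`SeparatedAffinePreimage.isAffineOpen_inf_preimage`, cover independence `length_cechH1_eq_of_isAffineOpen`).
`hasTrivialCechH1_comp_of_dimTwo` is the skeleton's `stub_leray` (v2 1c500c14ab5120f7 :122 = v5 :132) with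
`Type u`/`Scheme.{u}` specialised to `Type`/`Scheme.{0}`, binders byte-identical otherwise.

ROLE NAMES: in the 2-reg skeleton `stub_leray` the TOP scheme is called `X` and the middle one `Y₁`; in the
Genus files and in the first four theorems below the top scheme is `Z` and the middle one `X`.

References: A. Grothendieck, EGA III₁ (1961), Prop. (1.4.15) [`EGAIII1`]; U. Görtz, T. Wedhorn II (2023),
Lemma 22.1, Cor. 21.82 [`GortzWedhorn2023`]; R. Hartshorne (1977), III Thm. 4.5 [`Hartshorne1977`];
M. Temkin, Adv. Math. 219 (2008) §2.1 [`Temkin2008`].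
-/

noncomputable section
set_option linter.dupNamespace false

namespace Summit.ResolutionOfSingularities.ResolutionOfSingularities.Theorems.SurfaceTermination.GenusDescent

open CategoryTheory CategoryTheory.Limits AlgebraicGeometry TopologicalSpace IsLocalRing
open Literature.AlgebraicGeometry.Resolution Literature.AlgebraicGeometry.Morphisms
open Literature.AlgebraicGeometry.Morphisms.CechLocalization
open Summit.ResolutionOfSingularities.ResolutionOfSingularities.Theorems
open Summit.ResolutionOfSingularities.ResolutionOfSingularities.Theorems.NoZeno.SandwichCluster

/-! ## (L1) pointwise vanishing at a point of dimension ≤ 2, the dimension-2 case as a HYPOTHESIS -/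

section Pointwise

variable {X Z : Scheme.{0}} [IsIntegral X] [NoetherianSpace X] [NoetherianSpace Z]
  (ρ : Z ⟶ X) [IsProper ρ] (x : X)

set_option maxHeartbeats 400000 in
/-- **(L1) `Ȟ¹ = 0` on the base change of a proper birational `ρ : Z → X` (`Z` regular) to `Spec 𝒪_{X,x}` at a
REGULAR point `x` of dimension `≤ 2`, the dimension-two case being a HYPOTHESIS `hpt2`** — the named-fact-free
form of `GenusDescent.hasTrivialCechH1_pullback_snd_fromSpecStalk` (there the dimension-two case is Lipman
(1.2) 2)); for `dim 𝒪_{X,x} ≤ 1` the base change is an isomorphism onto `Spec 𝒪_{X,x}`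
(`isIso_of_isBirational_of_ringKrullDim_le_one`), hence affine, and Čech `H¹` of an affine scheme vanishes
(`cechH1_affine_vanishing_holds`, Görtz–Wedhorn II 22.1). [cite: Temkin2008, §2.1 (p. 6)]
[cite: GortzWedhorn2023, Lemma 22.1] -/
theorem hasTrivialCechH1_pullback_snd_fromSpecStalk_of_dimTwo (hρ : IsBirational ρ) (hZ : Scheme.IsRegular Z)
    (hx : IsRegularLocalRing (X.presheaf.stalk x)) (hdim : ringKrullDim (X.presheaf.stalk x) ≤ 2)
    (hpt2 : ringKrullDim (X.presheaf.stalk x) = 2 →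
      HasTrivialCechH1 (pullback.snd ρ (X.fromSpecStalk x))) :
    HasTrivialCechH1 (pullback.snd ρ (X.fromSpecStalk x)) := by
  obtain ⟨hres, hint⟩ := isResolution_pullback_snd_fromSpecStalk ρ x hρ hZ
  haveI := hx
  haveI := hint
  haveI : IsIntegrallyClosed (X.presheaf.stalk x) := isIntegrallyClosed_of_isRegularLocalRing _
  by_cases h2 : ringKrullDim (X.presheaf.stalk x) = 2
  · -- dimension two: the hypothesis
    exact hpt2 h2
  · -- dimension `≤ 1`: the base change is an isomorphism, hence affine
    have h1 : ringKrullDim (X.presheaf.stalk x) ≤ 1 := by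
      have hb := ringKrullDim_ne_bot (R := X.presheaf.stalk x)
      have ht := ringKrullDim_ne_top (R := X.presheaf.stalk x)
      obtain ⟨m, hm⟩ := WithBot.ne_bot_iff_exists.mp hb
      rw [← hm] at hdim h2 ht ⊢
      have hmt : m ≠ ⊤ := fun h => ht (by rw [h]; rfl)
      obtain ⟨n, hn⟩ := ENat.ne_top_iff_exists.mp hmt
      rw [← hn] at hdim h2 ⊢
      have hle' : (n : ℕ∞) ≤ 2 := by
        rw [show (2 : WithBot ℕ∞) = ((2 : ℕ∞) : WithBot ℕ∞) from rfl] at hdim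
        exact WithBot.coe_le_coe.mp hdim
      have hle : n ≤ 2 := by
        rw [show (2 : ℕ∞) = ((2 : ℕ) : ℕ∞) from rfl] at hle'
        exact ENat.coe_le_coe.mp hle'
      have hne : n ≠ 2 := fun h => h2 (by rw [h]; rfl)
      have h1' : (n : ℕ∞) ≤ 1 := by
        rw [show (1 : ℕ∞) = ((1 : ℕ) : ℕ∞) from rfl]
        exact ENat.coe_le_coe.mpr (by omega)
      rw [show (1 : WithBot ℕ∞) = ((1 : ℕ∞) : WithBot ℕ∞) from rfl]
      exact WithBot.coe_le_coe.mpr h1'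
    haveI := hres.isProper
    haveI := isIso_of_isBirational_of_ringKrullDim_le_one (X.presheaf.stalk x) h1
      (pullback.snd ρ (X.fromSpecStalk x)) hres.isBirational
    haveI : IsAffine (pullback ρ (X.fromSpecStalk x)) :=
      IsAffine.of_isIso (pullback.snd ρ (X.fromSpecStalk x))
    intro ι _ U hU hcov
    refine ⟨fun a b => ?_⟩
    obtain ⟨za, rfl⟩ := CechH1.mk_surjective _ U a
    obtain ⟨zb, rfl⟩ := CechH1.mk_surjective _ U b
    have hv := cechH1_affine_vanishing_holds (pullback.snd ρ (X.fromSpecStalk x))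
      (isAffineOpen_top _) U hcov
    rw [(CechH1.mk_eq_zero_iff _ U za).mpr (hv za.2), (CechH1.mk_eq_zero_iff _ U zb).mpr (hv zb.2)]

end Pointwise

/-! ## (L2), (L3) the chart lemma and the refinement surjection, POINTWISE forms -/

section Chart

variable {T : Type} [CommRing T] {X Z : Scheme.{0}} [IsIntegral X] [NoetherianSpace X]
  [NoetherianSpace Z] (πX : X ⟶ Spec (.of T)) (ρ : Z ⟶ X) [IsProper ρ]

omit [IsIntegral X] [NoetherianSpace X] [NoetherianSpace Z] [IsProper ρ] in
/-- **(L2) chartwise `R¹ρ_*𝒪_Z = 0`, pointwise form**: for `ρ : Z → X` over `πX : X → Spec T`, an affine open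
`U ⊆ X` such that `Ȟ¹ = 0` on `Z ×_X Spec 𝒪_{X,x} → Spec 𝒪_{X,x}` for every `x ∈ U`, and a finite family `𝒢` of
affine opens of `Z` with `⋃ 𝒢 = ρ⁻¹U` and affine pairwise and triple intersections: `Ȟ¹(𝒢, 𝒪_Z) = 0`.  This is
`GenusDescent.cechZ1_le_cechB1_chart` with its binders `(h12) (hρ) (hZ) (hX) (hdimX)` — used there only through
the pointwise vanishing at the points of `U` — replaced by that pointwise vanishing `hpt` itself (same proof:
transport to the chart `ρ⁻¹U`, local-to-global criterion `cechZ1_le_cechB1_of_forall_stalk` over `Γ(X, U)`,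
base change to `Spec 𝒪_{X,x}` at each maximal ideal). [cite: EGAIII1, Prop. (1.4.15)] -/
theorem cechZ1_le_cechB1_chart_of_forall_stalk_mem {U : X.Opens} (hpt : ∀ x ∈ U, HasTrivialCechH1 (pullback.snd ρ (X.fromSpecStalk x)))
    (hU : IsAffineOpen U) {κ : Type} [Finite κ] (G : κ → Z.Opens) (hGcov : ⨆ j, G j = ρ ⁻¹ᵁ U)
    (hG : ∀ j, IsAffineOpen (G j)) (hG2 : ∀ j j', IsAffineOpen (G j ⊓ G j'))
    (hG3 : ∀ j j' j'', IsAffineOpen (G j ⊓ G j' ⊓ G j'')) :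
    cechZ1 (ρ ≫ πX) G ≤ cechB1 (ρ ≫ πX) G := by
  classical
  have hGle : ∀ j, G j ≤ ρ ⁻¹ᵁ U := fun j => hGcov ▸ le_iSup G j
  -- (A) transport to the chart `ρ⁻¹U` along the open immersion `ι = (ρ⁻¹U).ι`
  have hbij : ∀ V : Z.Opens, V ≤ ρ ⁻¹ᵁ U →
      Function.Bijective (Sections.comap (ρ ≫ πX) ((ρ ⁻¹ᵁ U).ι ≫ ρ ≫ πX) (ρ ⁻¹ᵁ U).ι rfl
        (le_refl ((ρ ⁻¹ᵁ U).ι ⁻¹ᵁ V))) := by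
    intro V hV
    have hVr : V ≤ (ρ ⁻¹ᵁ U).ι.opensRange := by rwa [Scheme.Opens.opensRange_ι]
    haveI := (ρ ⁻¹ᵁ U).ι.isIso_app V hVr
    rw [show (Sections.comap (ρ ≫ πX) ((ρ ⁻¹ᵁ U).ι ≫ ρ ≫ πX) (ρ ⁻¹ᵁ U).ι rfl
        (le_refl ((ρ ⁻¹ᵁ U).ι ⁻¹ᵁ V)) : _ → _) = ((ρ ⁻¹ᵁ U).ι.app V).hom from by
      funext s; rw [Sections.comap_apply, Scheme.Hom.appLE_eq_app]]
    exact ConcreteCategory.bijective_of_isIso ((ρ ⁻¹ᵁ U).ι.app V)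
  refine cechZ1_le_cechB1_of_comap (ρ ≫ πX) ((ρ ⁻¹ᵁ U).ι ≫ ρ ≫ πX) (ρ ⁻¹ᵁ U).ι rfl G
    (fun j => (hbij (G j) (hGle j)).2)
    (fun j j' => (hbij (G j ⊓ G j') (inf_le_left.trans (hGle j))).1) ?_
  -- (B) regard the chart as a `Γ(X, U)`-scheme via `ρ ∣_ U`
  rw [cechZ1_le_cechB1_iff_of_base ((ρ ⁻¹ᵁ U).ι ≫ ρ ≫ πX) ((ρ ∣_ U) ≫ hU.isoSpec.hom)]
  have haffι : ∀ V : Z.Opens, V ≤ ρ ⁻¹ᵁ U → IsAffineOpen V →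
      IsAffineOpen ((ρ ⁻¹ᵁ U).ι ⁻¹ᵁ V) := by
    intro V hV hVa
    rw [← (ρ ⁻¹ᵁ U).ι.isAffineOpen_iff_of_isOpenImmersion,
      Scheme.Hom.image_preimage_eq_opensRange_inf, Scheme.Opens.opensRange_ι, inf_eq_right.mpr hV]
    exact hVa
  have hG' : ∀ j, IsAffineOpen (preimageFamily (ρ ⁻¹ᵁ U).ι G j) := fun j =>
    haffι (G j) (hGle j) (hG j)
  have hG2' : ∀ j j', IsAffineOpen (preimageFamily (ρ ⁻¹ᵁ U).ι G j ⊓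
      preimageFamily (ρ ⁻¹ᵁ U).ι G j') := fun j j' =>
    haffι (G j ⊓ G j') (inf_le_left.trans (hGle j)) (hG2 j j')
  have hG3' : ∀ j j' j'', IsAffineOpen (preimageFamily (ρ ⁻¹ᵁ U).ι G j ⊓
      preimageFamily (ρ ⁻¹ᵁ U).ι G j' ⊓ preimageFamily (ρ ⁻¹ᵁ U).ι G j'') := fun j j' j'' =>
    haffι (G j ⊓ G j' ⊓ G j'') ((inf_le_left.trans inf_le_left).trans (hGle j)) (hG3 j j' j'')
  refine cechZ1_le_cechB1_of_forall_stalk ((ρ ∣_ U) ≫ hU.isoSpec.hom) (preimageFamily (ρ ⁻¹ᵁ U).ι G)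
    hG' hG2' hG3' ?_
  -- (C) at a maximal ideal `𝔪 ↔ x ∈ U`: base change to `Spec 𝒪_{X,x}` and pointwise vanishing
  intro 𝔪 h𝔪
  let y : PrimeSpectrum Γ(X, U) := ⟨𝔪, h𝔪.isPrime⟩
  have hx : hU.fromSpec.base y ∈ U := by
    have h : hU.fromSpec.base y ∈ hU.fromSpec.opensRange := ⟨y, rfl⟩
    rwa [hU.opensRange_fromSpec] at h
  letI alg : Algebra Γ(X, U) (X.presheaf.stalk (hU.fromSpec.base y)) :=
    TopCat.Presheaf.algebra_section_stalk X.presheaf ⟨hU.fromSpec.base y, hx⟩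
  have hloc : IsLocalization.AtPrime (X.presheaf.stalk (hU.fromSpec.base y)) y.asIdeal :=
    hU.isLocalization_stalk' y hx
  have hgerm : CommRingCat.ofHom (algebraMap Γ(X, U) (X.presheaf.stalk (hU.fromSpec.base y))) =
      X.presheaf.germ U (hU.fromSpec.base y) hx := rfl
  -- right square: the chart over `Spec Γ(X, U) ≅ U ⊆ X`
  have t : IsPullback (ρ ⁻¹ᵁ U).ι ((ρ ∣_ U) ≫ hU.isoSpec.hom) ρ (hU.isoSpec.inv ≫ U.ι) :=
    (isPullback_morphismRestrict ρ U).flip.of_iso (Iso.refl _) (Iso.refl _) hU.isoSpec (Iso.refl _)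
      (by simp) (by simp) (by simp) (by simp)
  -- outer square: Mathlib's base change to `Spec 𝒪_{X,x}`
  have hφ : X.fromSpecStalk (hU.fromSpec.base y) =
      Spec.map (CommRingCat.ofHom (algebraMap Γ(X, U) (X.presheaf.stalk (hU.fromSpec.base y)))) ≫
        (hU.isoSpec.inv ≫ U.ι) := by
    rw [hgerm, hU.isoSpec_inv_ι, ← hU.fromSpecStalk_eq_fromSpecStalk hx]; rfl
  have s : IsPullback (pullback.fst ρ (X.fromSpecStalk (hU.fromSpec.base y)))
      (pullback.snd ρ (X.fromSpecStalk (hU.fromSpec.base y))) ρ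
      (Spec.map (CommRingCat.ofHom (algebraMap Γ(X, U) (X.presheaf.stalk (hU.fromSpec.base y)))) ≫
        (hU.isoSpec.inv ≫ U.ι)) :=
    (IsPullback.of_hasPullback ρ (X.fromSpecStalk (hU.fromSpec.base y))).of_iso (Iso.refl _)
      (Iso.refl _) (Iso.refl _) (Iso.refl _) (by simp only [Iso.refl_hom, Category.comp_id,
        Category.id_comp]) (by simp only [Iso.refl_hom, Category.comp_id, Category.id_comp])
      (by simp only [Iso.refl_hom, Category.comp_id, Category.id_comp])
      (by simp only [Iso.refl_hom, Category.comp_id, Category.id_comp]; exact hφ)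
  have H := IsPullback.of_right' s t
  refine ⟨X.presheaf.stalk (hU.fromSpec.base y), inferInstance, alg, hloc,
    pullback ρ (X.fromSpecStalk (hU.fromSpec.base y)),
    pullback.snd ρ (X.fromSpecStalk (hU.fromSpec.base y)), _, H, ?_⟩
  -- pointwise vanishing (`hpt`) in the `𝒪_{X,x}`-structure
  rw [cechZ1_le_cechB1_iff_of_base _ (pullback.snd ρ (X.fromSpecStalk (hU.fromSpec.base y)))]
  apply cechZ1_le_cechB1_of_subsingleton
  have htriv := hpt (hU.fromSpec.base y) hx
  haveI : IsAffineHom (t.lift (pullback.fst ρ (X.fromSpecStalk (hU.fromSpec.base y)))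
      (pullback.snd ρ (X.fromSpecStalk (hU.fromSpec.base y)) ≫
        Spec.map (CommRingCat.ofHom (algebraMap Γ(X, U) (X.presheaf.stalk (hU.fromSpec.base y)))))
      (by rw [s.w, Category.assoc])) :=
    isAffineHom_isStableUnderBaseChange.of_isPullback H.flip inferInstance
  refine htriv κ _ (fun j => (hG' j).preimage _) ?_
  change ⨆ j, _ ⁻¹ᵁ ((ρ ⁻¹ᵁ U).ι ⁻¹ᵁ G j) = ⊤
  rw [← Scheme.Hom.preimage_iSup, ← Scheme.Hom.preimage_iSup, hGcov, Scheme.Opens.ι_preimage_self]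
  rfl

omit [NoetherianSpace X] [NoetherianSpace Z] in
/-- **(L3) Leray in degree one along a domination, pointwise form: `Ȟ¹(𝒰, 𝒪_X) ↠ Ȟ¹(𝒲, 𝒪_Z)`** for
`ρ : Z → X` proper birational, `X` regular integral (so `ρ_*𝒪_Z = 𝒪_X`, `isIso_app_of_isBirational_of_isRegular`),
`Ȟ¹ = 0` on `Z ×_X Spec 𝒪_{X,x} → Spec 𝒪_{X,x}` for every `x`, a finite family `𝒰` of affine opens of `X` and a
finite affine open cover `𝒲` of `Z` refining `ρ⁻¹𝒰` via `τ` (the opens `ρ⁻¹U_i ∩ W_j` and their pairwise and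
triple intersections affine): the composite `Ȟ¹(𝒰, 𝒪_X) → Ȟ¹(ρ⁻¹𝒰, 𝒪_Z) → Ȟ¹(𝒲, 𝒪_Z)` is surjective.  This is
`GenusDescent.cechRefineH1_comp_cechComapH1_surjective` with `(h12) (hZ) (hdimX)` replaced by the pointwise
vanishing `hpt` (same proof, through `cechZ1_le_cechB1_chart_of_forall_stalk_mem`).
[cite: GortzWedhorn2023, Cor. 21.82 (p. 265)] -/
theorem cechRefineH1_comp_cechComapH1_surjective_of_forall_stalk [IsIntegral Z] (hρ : IsBirational ρ) (hX : Scheme.IsRegular X)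
    (hpt : ∀ x : X, HasTrivialCechH1 (pullback.snd ρ (X.fromSpecStalk x)))
    {ι : Type} [Finite ι] (U : ι → X.Opens) (hU : ∀ i, IsAffineOpen (U i))
    {κ : Type} [Finite κ] (W : κ → Z.Opens) (hWcov : ⨆ j, W j = ⊤) (τ : κ → ι)
    (hτ : ∀ j, W j ≤ ρ ⁻¹ᵁ U (τ j)) (hUW : ∀ i j, IsAffineOpen (ρ ⁻¹ᵁ U i ⊓ W j))
    (hUW2 : ∀ i j j', IsAffineOpen (ρ ⁻¹ᵁ U i ⊓ W j ⊓ (ρ ⁻¹ᵁ U i ⊓ W j')))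
    (hUW3 : ∀ i j j' j'',
      IsAffineOpen (ρ ⁻¹ᵁ U i ⊓ W j ⊓ (ρ ⁻¹ᵁ U i ⊓ W j') ⊓ (ρ ⁻¹ᵁ U i ⊓ W j''))) :
    Function.Surjective
      (cechRefineH1 (ρ ≫ πX) (preimageFamily ρ U) W τ hτ ∘ₗ cechComapH1 πX (ρ ≫ πX) ρ rfl U) := by
  rw [LinearMap.coe_comp]
  refine Function.Surjective.comp ?_ ?_
  · refine cechRefineH1_surjective (ρ ≫ πX) (preimageFamily ρ U) W τ hτ (fun i => ?_) fun i => ?_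
    · rw [hWcov]; exact le_top
    · exact cechZ1_le_cechB1_chart_of_forall_stalk_mem πX ρ (fun x _ => hpt x) (hU i) (fun j => ρ ⁻¹ᵁ U i ⊓ W j)
        (by rw [← inf_iSup_eq, hWcov, inf_top_eq]) (hUW i) (hUW2 i) (hUW3 i)
  · haveI := fun V : X.Opens => isIso_app_of_isBirational_of_isRegular ρ hρ hX V
    exact cechComapH1_surjective_of_appLE_bijective πX (ρ ≫ πX) ρ rfl U
      (fun i i' => comap_bijective_of_isIso_app πX ρ _ rfl)
      (fun i i' i'' => (comap_bijective_of_isIso_app πX ρ _ rfl).1)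

end Chart

/-! ## (L4) the gluing: `Ȟ¹(X, 𝒪) = 0 ⇒ Ȟ¹(Z, 𝒪) = 0` for every finite affine cover of `Z` -/

section Glue

variable {T : Type} [CommRing T] {X Z : Scheme.{0}}

/-- **(L4) Leray in degree one, global form with a pointwise hypothesis**: for `ρ : Z → X` proper birational,
`Z` regular, `X` regular integral, `πX : X → Spec T` proper, if `Ȟ¹ = 0` on `Z ×_X Spec 𝒪_{X,x} → Spec 𝒪_{X,x}`
at every point `x` and `Ȟ¹(X, 𝒪_X) = 0` on every finite affine open cover (`HasTrivialCechH1 πX`), then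
`Ȟ¹(Z, 𝒪_Z) = 0` on every finite affine open cover (`HasTrivialCechH1 (ρ ≫ πX)`): take a finite affine cover
`𝒰` of `X` and a finite affine cover `𝒲` of `Z` refining `ρ⁻¹𝒰` (`exists_finite_affine_cover`,
`exists_finite_affine_refinement`; the mixed intersections are affine since `Z` is separated over the affine
base, `SeparatedAffinePreimage.isAffineOpen_inf_preimage`), so `Ȟ¹(𝒰, 𝒪_X) = 0 ↠ Ȟ¹(𝒲, 𝒪_Z)` by (L3), and
`Ȟ¹` of the GIVEN finite affine cover of `Z` has the same length as `Ȟ¹(𝒲, 𝒪_Z)`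
(`length_cechH1_eq_of_isAffineOpen`). [cite: GortzWedhorn2023, Cor. 21.82 (p. 265)]
[cite: Hartshorne1977, III Thm. 4.5 (p. 222)] -/
theorem hasTrivialCechH1_comp_of_forall_stalk [IsIntegral X] [IsNoetherian X] [IsNoetherian Z] (πX : X ⟶ Spec (.of T)) [IsProper πX]
    (ρ : Z ⟶ X) [IsProper ρ] (hρ : IsBirational ρ) (hZ : Scheme.IsRegular Z) (hX : Scheme.IsRegular X)
    (hpt : ∀ x : X, HasTrivialCechH1 (pullback.snd ρ (X.fromSpecStalk x)))
    (h0 : HasTrivialCechH1 πX) : HasTrivialCechH1 (ρ ≫ πX) := by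
  classical
  haveI : IsIntegral Z := (⟨inferInstance, hρ, hZ⟩ : IsResolution ρ).isIntegral_source
  haveI : Z.IsSeparated := ⟨by rw [← terminal.comp_from (ρ ≫ πX)]; infer_instance⟩
  intro κ _ V hVaff hVcov
  -- a finite affine cover `𝒰` of `X` and a finite affine cover `𝒲` of `Z` refining `ρ⁻¹𝒰`
  obtain ⟨ι', _, UX, hUXaff, hUXcov⟩ := exists_finite_affine_cover X
  obtain ⟨κ', _, WZ, rZ, hWZaff, hWZr, hWZcov⟩ := exists_finite_affine_refinement Z
    (fun i => ρ ⁻¹ᵁ UX i) (by rw [← Scheme.Hom.preimage_iSup, hUXcov]; exact Opens.map_top _)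
  -- affine intersections (`X` separated over the affine base)
  have hUW : ∀ i j, IsAffineOpen (ρ ⁻¹ᵁ UX i ⊓ WZ j) := fun i j => by
    rw [inf_comm]
    exact SeparatedAffinePreimage.isAffineOpen_inf_preimage ρ πX (hWZaff j) (hUXaff i)
  have hUW2 : ∀ i j j', IsAffineOpen (ρ ⁻¹ᵁ UX i ⊓ WZ j ⊓ (ρ ⁻¹ᵁ UX i ⊓ WZ j')) := by
    intro i j j'
    rw [inf_comm (ρ ⁻¹ᵁ UX i) (WZ j), inf_comm (ρ ⁻¹ᵁ UX i) (WZ j'), inf_inf_inf_inf_eq]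
    exact SeparatedAffinePreimage.isAffineOpen_inf_preimage ρ πX ((hWZaff j).inf (hWZaff j'))
      (hUXaff i)
  have hUW3 : ∀ i j j' j'', IsAffineOpen
      (ρ ⁻¹ᵁ UX i ⊓ WZ j ⊓ (ρ ⁻¹ᵁ UX i ⊓ WZ j') ⊓ (ρ ⁻¹ᵁ UX i ⊓ WZ j'')) := by
    intro i j j' j''
    rw [inf_comm (ρ ⁻¹ᵁ UX i) (WZ j), inf_comm (ρ ⁻¹ᵁ UX i) (WZ j'), inf_comm (ρ ⁻¹ᵁ UX i) (WZ j''),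
      inf_inf_inf_inf_inf_eq]
    exact SeparatedAffinePreimage.isAffineOpen_inf_preimage ρ πX
      (((hWZaff j).inf (hWZaff j')).inf (hWZaff j'')) (hUXaff i)
  -- `Ȟ¹(𝒰, 𝒪_X) = 0 ↠ Ȟ¹(𝒲, 𝒪_Z)`
  have hsurj := cechRefineH1_comp_cechComapH1_surjective_of_forall_stalk πX ρ hρ hX hpt UX hUXaff WZ hWZcov rZ hWZr hUW hUW2 hUW3
  haveI : Subsingleton (CechH1 πX UX) := h0 ι' UX hUXaff hUXcov
  have hW : Subsingleton (CechH1 (ρ ≫ πX) WZ) := hsurj.subsingleton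
  -- independence of the affine cover: `𝒲` versus the given `𝒱`
  have e := length_cechH1_eq_of_isAffineOpen (ρ ≫ πX) V WZ hVaff hWZaff hVcov hWZcov
  have h0' : Module.length T (CechH1 (ρ ≫ πX) WZ) = 0 := Module.length_eq_zero_iff.mpr hW
  rw [← e] at h0'
  exact Module.length_eq_zero_iff.mp h0'

/-- **(L) Leray + localisation with a pointwise hypothesis** (row F79-L(Ⅰ) of the F-79 «2-reg» cell; the
skeleton's `stub_leray` at universe `0`, binders byte-identical otherwise): for `ρ : X → Y₁` proper birational
between regular schemes over `Spec T` (`bl : Y₁ → Spec T` proper, `Y₁` integral Noetherian with local rings of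
dimension `≤ 2`), if `Ȟ¹` vanishes on the base change of `ρ` to `Spec 𝒪_{Y₁,y}` at every point `y` of dimension
`2` and `Ȟ¹(Y₁, 𝒪) = 0`, then `Ȟ¹(X, 𝒪) = 0` — from (L1) (the points of dimension `≤ 1` need no hypothesis) and
(L4). [cite: EGAIII1, Prop. (1.4.15)] [cite: StacksProject, Tag 0AY8] -/
theorem hasTrivialCechH1_comp_of_dimTwo {T : Type} [CommRing T] {X Y₁ : Scheme.{0}} [IsIntegral Y₁] [IsNoetherian Y₁]
    [IsNoetherian X] (bl : Y₁ ⟶ Spec (.of T)) [IsProper bl] (ρ : X ⟶ Y₁) [IsProper ρ]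
    (hρ : IsBirational ρ) (hX : Scheme.IsRegular X) (hY : Scheme.IsRegular Y₁)
    (hdimY : ∀ y : Y₁, ringKrullDim (Y₁.presheaf.stalk y) ≤ 2)
    (hpt : ∀ y : Y₁, ringKrullDim (Y₁.presheaf.stalk y) = 2 →
      HasTrivialCechH1 (pullback.snd ρ (Y₁.fromSpecStalk y)))
    (hY1 : HasTrivialCechH1 bl) : HasTrivialCechH1 (ρ ≫ bl) :=
  hasTrivialCechH1_comp_of_forall_stalk bl ρ hρ hX hY (fun y => hasTrivialCechH1_pullback_snd_fromSpecStalk_of_dimTwo ρ y hρ hX (hY y) (hdimY y) (hpt y)) hY1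

end Glue

end Summit.ResolutionOfSingularities.ResolutionOfSingularities.Theorems.SurfaceTermination.GenusDescent

end
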